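import Summits.NavierStokesRegularity.NavierStokesRegularity.Theorems.PoloidalWindowDoorPoloidalWindowRigidityZShockPSystemLiouvilleDivergent
import HarnessLib

/-!
# Crux K2 `PoloidalWindowRigidity` (stmt-NavierStokesRegularity-19708), line `z_shock` — rung R2, non-uniform genuine nonlinearity:
# the QUANTITATIVE BACKWARD BUDGET along a forward characteristic

`--supports stmt-NavierStokesRegularity-19708 --as helper` (leafhand-ns-poloidalwindowdoor-3 g2, cell decomp-ns, 2026-08-31; sequel of
`…ZShockRiccatiDivergent` p822599 and `…ZShockPSystemLiouvilleDivergent` p822662).  Class-free, Mathlib + tree files only.  **No stub and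
no summit is closed by this file; Navier–Stokes regularity is NOT proved here (rung 0).**

The contrapositive, quantitative form of the non-uniform R2 kernel — the input of step 1 of the attack on the residual recurrence
statement (R2′) recorded in the evidence memo `R2-NONUNIFORM-leafhand-3-g2.md` on the crux item: a positive transversal derivative
`r_x(z₀) > 0` of the forward Riemann invariant `r = p + K(w)` bounds the genuine nonlinearity `∫_{z₁}^{z₀} κ'(w(z, X z)) dz` accumulated
BEHIND it along the forward characteristic `X`, uniformly in `z₁ ≤ z₀` — so along such a characteristic `w` must settle (in integrated
`κ'`-measure) onto the degenerate set of the slope function as `z → −∞`.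

* `dampedRiccati_backward_budget` — on `[z₁, z₀]`: `α' = −aα² − h'α`, `a ≥ ã ≥ 0`, `|h| ≤ H`, `Ã' = ã`, `α(z₀) > 0` ⇒
  `Ã(z₀) − Ã(z₁) < e^{2H}/α(z₀)` (the tree's `dampedRiccati_backward_lifespan` is `ã ≡ a₀`);
* `pSystem_backward_budget` — ★ for a `C²` solution of `p_z = −κ(w)² w_x`, `w_z = −p_x` with `0 < κlo ≤ κ(w) ≤ κhi`, `κ'(w) ≥ 0`
  along the solution, a global forward characteristic `X` and an antiderivative `A` of `κ'(w(·, X ·))`: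
  `r_x(z₀, X z₀) > 0 ⇒ A(z₀) − A(z₁) < 2κhi·e^{|log κlo| + |log κhi|}/r_x(z₀, X z₀)` for all `z₁ ≤ z₀`.

[folklore] (Lax 1964 (2.6); John 1974 §2)
-/

noncomputable section

namespace Summit.NavierStokesRegularity.NavierStokesRegularity.Theorems.PoloidalWindowDoorPoloidalWindowRigidityZShockPSystemBackwardBudget

-- the summit and its single sub-problem share the name (CONVENTIONS §1)
set_option linter.dupNamespace false

open Set Filter Topology Function Metric
open Summit.NavierStokesRegularity.NavierStokesRegularity.Theorems.PoloidalWindowDoorPoloidalWindowRigidityZShockRiccatiTwoSided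
open Summit.NavierStokesRegularity.NavierStokesRegularity.Theorems.PoloidalWindowDoorPoloidalWindowRigidityZShockRiccatiDivergent
open Summit.NavierStokesRegularity.NavierStokesRegularity.Theorems.PoloidalWindowDoorPoloidalWindowRigidityZShockCharacteristicRiccati
open Summit.NavierStokesRegularity.NavierStokesRegularity.Theorems.PoloidalWindowDoorPoloidalWindowRigidityZShockPSystemLiouville

/-! ## The quantitative backward budget -/

/-- **Damped law, backward budget with a minorant.**  On `[z₁, z₀]`: `α' = −aα² − h'α` with `a ≥ ã ≥ 0`, `|h| ≤ H`, `Ã' = ã` and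
`α(z₀) > 0` ⇒ `Ã(z₀) − Ã(z₁) < e^{2H}/α(z₀)` (John's substitution `q = e^{h}α`, minorant `e^{−H}ã` of the coefficient `a e^{−h}`,
`antideriv_incr_lt_inv_of_riccati_backward`, and `1/q(z₀) ≤ e^{H}/α(z₀)`).  The tree's `dampedRiccati_backward_lifespan` is the case
`ã ≡ a₀`. [folklore] -/
theorem dampedRiccati_backward_budget {α a ã h h' A : ℝ → ℝ} {z₁ z₀ H : ℝ} (hz : z₁ ≤ z₀)
    (hã : ∀ z ∈ Icc z₁ z₀, 0 ≤ ã z) (hãa : ∀ z ∈ Icc z₁ z₀, ã z ≤ a z) (hH : ∀ z ∈ Icc z₁ z₀, |h z| ≤ H)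
    (hh : ∀ z ∈ Icc z₁ z₀, HasDerivAt h (h' z) z) (hA : ∀ z ∈ Icc z₁ z₀, HasDerivAt A (ã z) z)
    (hα : ∀ z ∈ Icc z₁ z₀, HasDerivAt α (-(a z * α z ^ 2) - h' z * α z) z) (hpos : 0 < α z₀) :
    A z₀ - A z₁ < Real.exp (2 * H) / α z₀ := by
  set q : ℝ → ℝ := fun z => Real.exp (h z) * α z with hq
  have hqd : ∀ z ∈ Icc z₁ z₀, HasDerivAt q (-(a z * Real.exp (-h z) * q z ^ 2)) z := by
    intro z hzI
    have he : HasDerivAt (fun y => Real.exp (h y)) (Real.exp (h z) * h' z) z := (hh z hzI).exp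
    refine (he.mul (hα z hzI)).congr_deriv ?_
    have hexp : Real.exp (-h z) * Real.exp (h z) = 1 := by rw [← Real.exp_add]; simp
    simp only [hq]
    have : a z * Real.exp (-h z) * (Real.exp (h z) * α z) ^ 2 =
        a z * α z ^ 2 * Real.exp (h z) * (Real.exp (-h z) * Real.exp (h z)) := by ring
    rw [this, hexp]
    ring
  have ha0 : ∀ z ∈ Icc z₁ z₀, 0 ≤ a z := fun z hzI => (hã z hzI).trans (hãa z hzI)
  have hβ : ∀ z ∈ Icc z₁ z₀, 0 ≤ Real.exp (-H) * ã z := fun z hzI => mul_nonneg (Real.exp_pos _).le (hã z hzI)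
  have hβb : ∀ z ∈ Icc z₁ z₀, Real.exp (-H) * ã z ≤ a z * Real.exp (-h z) := by
    intro z hzI
    have h1 : Real.exp (-H) ≤ Real.exp (-h z) :=
      Real.exp_le_exp.2 (by linarith [hH z hzI, le_abs_self (h z)])
    calc Real.exp (-H) * ã z ≤ Real.exp (-H) * a z := mul_le_mul_of_nonneg_left (hãa z hzI) (Real.exp_pos _).le
      _ ≤ Real.exp (-h z) * a z := mul_le_mul_of_nonneg_right h1 (ha0 z hzI)
      _ = a z * Real.exp (-h z) := mul_comm _ _
  have hB : ∀ z ∈ Icc z₁ z₀, HasDerivAt (fun z => Real.exp (-H) * A z) (Real.exp (-H) * ã z) z :=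
    fun z hzI => (hA z hzI).const_mul _
  have hq₀ : 0 < q z₀ := mul_pos (Real.exp_pos _) hpos
  have hbud := antideriv_incr_lt_inv_of_riccati_backward (b := fun z => a z * Real.exp (-h z)) hz hqd hβ hβb hB hq₀
  -- `1/q(z₀) ≤ e^{H}/α(z₀)` and `e^{-H} (A z₀ - A z₁) < 1/q(z₀)` give the claim
  have hE : 0 < Real.exp (-H) := Real.exp_pos _
  have hqz₀ : Real.exp (-H) * α z₀ ≤ q z₀ := by
    have h1 : Real.exp (-H) ≤ Real.exp (h z₀) :=
      Real.exp_le_exp.2 (by linarith [hH z₀ (right_mem_Icc.2 hz), neg_abs_le (h z₀)])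
    exact mul_le_mul_of_nonneg_right h1 hpos.le
  have hinv : (q z₀)⁻¹ ≤ (Real.exp (-H) * α z₀)⁻¹ := (inv_le_inv₀ hq₀ (mul_pos hE hpos)).2 hqz₀
  have h3 : Real.exp (-H) * (A z₀ - A z₁) < (Real.exp (-H) * α z₀)⁻¹ := by
    have : Real.exp (-H) * A z₀ - Real.exp (-H) * A z₁ = Real.exp (-H) * (A z₀ - A z₁) := by ring
    linarith [hbud, hinv, this]
  rw [mul_inv, mul_comm (Real.exp (-H))⁻¹, ← div_eq_mul_inv, lt_div_iff₀ hE] at h3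
  -- `h3 : e^{-H} (A z₀ − A z₁) e^{-H} < (α z₀)⁻¹`
  rw [lt_div_iff₀ hpos]
  have hEE : Real.exp (2 * H) * (Real.exp (-H) * Real.exp (-H)) = 1 := by
    rw [← Real.exp_add, ← Real.exp_add, show 2 * H + (-H + -H) = 0 by ring, Real.exp_zero]
  have h4 : (A z₀ - A z₁) * (Real.exp (-H) * Real.exp (-H)) < (α z₀)⁻¹ := by
    have : Real.exp (-H) * (A z₀ - A z₁) * Real.exp (-H) = (A z₀ - A z₁) * (Real.exp (-H) * Real.exp (-H)) := by ring
    linarith [h3, this]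
  have h5 := mul_lt_mul_of_pos_left h4 (Real.exp_pos (2 * H))
  rw [← mul_assoc, mul_comm (Real.exp (2 * H)) (A z₀ - A z₁), mul_assoc, hEE, mul_one] at h5
  -- `h5 : (A z₀ - A z₁) < e^{2H} (α z₀)⁻¹`
  calc (A z₀ - A z₁) * α z₀ < Real.exp (2 * H) * (α z₀)⁻¹ * α z₀ := mul_lt_mul_of_pos_right h5 hpos
    _ = Real.exp (2 * H) := by rw [mul_assoc, inv_mul_cancel₀ hpos.ne', mul_one]

/-- **★ Backward budget along a forward characteristic of the p-system** (step 1 of the attack on (R2′)).  Let `(w, p)` be a `C²`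
solution of the autonomous p-system on `ℝ × ℝ` with `0 < κlo ≤ κ(w) ≤ κhi` and `κ'(w) ≥ 0` along the solution, let `X` be a global
FORWARD characteristic (`X' = κ(w(z, X z))`) and `A` an antiderivative of `z ↦ κ'(w(z, X z))`.  If the transversal derivative of the
forward Riemann invariant `r = p + K(w)` is positive at height `z₀` on `X`, `r_x(z₀, X z₀) = p_x + κ(w) w_x > 0`, then for every `z₁ ≤ z₀`

  `A(z₀) − A(z₁) < 2 κhi · e^{|log κlo| + |log κhi|} / r_x(z₀, X z₀)` :

the genuine nonlinearity accumulated BEHIND a positive forward gradient is bounded, uniformly in `z₁` (so `∫_{−∞}^{z₀} κ'(w(z, X z)) dz`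
converges).  This is the contrapositive, quantitative content of `pSystem_derivs_eq_zero_of_divergent` for one characteristic; no bound on
`w_x` or `κ'` is needed here because `X` is given. [folklore] -/
theorem pSystem_backward_budget {w p : ℝ × ℝ → ℝ} {κ κ' K : ℝ → ℝ} (hw : ContDiff ℝ 2 w) (hp : ContDiff ℝ 2 p)
    (hK2 : ContDiff ℝ 2 K) (hKd : ∀ v, HasDerivAt K (κ v) v) (hκd : ∀ v, HasDerivAt κ (κ' v) v)
    (hsys1 : ∀ q, fderiv ℝ p q (1, 0) = -(κ (w q) ^ 2 * fderiv ℝ w q (0, 1)))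
    (hsys2 : ∀ q, fderiv ℝ w q (1, 0) = -fderiv ℝ p q (0, 1))
    {κlo κhi : ℝ} (hκlo0 : 0 < κlo) (hκlo : ∀ q, κlo ≤ κ (w q)) (hκhi : ∀ q, κ (w q) ≤ κhi)
    (hgnl : ∀ q, 0 ≤ κ' (w q))
    {X : ℝ → ℝ} (hX : ∀ z, HasDerivAt X (κ (w (z, X z))) z)
    {A : ℝ → ℝ} (hA : ∀ z, HasDerivAt A (κ' (w (z, X z))) z) {z₁ z₀ : ℝ} (hz : z₁ ≤ z₀)
    (hpos : 0 < fderiv ℝ p (z₀, X z₀) (0, 1) + κ (w (z₀, X z₀)) * fderiv ℝ w (z₀, X z₀) (0, 1)) :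
    A z₀ - A z₁ < 2 * κhi * Real.exp (|Real.log κlo| + |Real.log κhi|) /
      (fderiv ℝ p (z₀, X z₀) (0, 1) + κ (w (z₀, X z₀)) * fderiv ℝ w (z₀, X z₀) (0, 1)) := by
  have hw1 : Differentiable ℝ w := hw.differentiable (by simp)
  have hp1 : Differentiable ℝ p := hp.differentiable (by simp)
  have hκpos : ∀ q, 0 < κ (w q) := fun q => hκlo0.trans_le (hκlo q)
  have hκhi0 : 0 < κhi := hκlo0.trans_le ((hκlo 0).trans (hκhi 0))
  -- the forward Riemann invariant and its equation
  set r : ℝ × ℝ → ℝ := fun q => p q + K (w q) with hrdef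
  have hr2 : ContDiff ℝ 2 r := hp.add (hK2.comp hw)
  have hKw : ∀ q, HasFDerivAt (fun q' => K (w q')) (κ (w q) • fderiv ℝ w q) q :=
    fun q => (hKd (w q)).comp_hasFDerivAt q (hw1 q).hasFDerivAt
  have hrF : ∀ q, HasFDerivAt r (fderiv ℝ p q + κ (w q) • fderiv ℝ w q) q :=
    fun q => (hp1 q).hasFDerivAt.add (hKw q)
  have hrD : ∀ q v, fderiv ℝ r q v = fderiv ℝ p q v + κ (w q) * fderiv ℝ w q v := by
    intro q v
    rw [(hrF q).fderiv]
    simp [smul_eq_mul]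
  set c₁ : ℝ × ℝ → ℝ := fun q => κ (w q) with hc₁
  have hκw : ∀ q, HasFDerivAt (fun q' => κ (w q')) (κ' (w q) • fderiv ℝ w q) q :=
    fun q => (hκd (w q)).comp_hasFDerivAt q (hw1 q).hasFDerivAt
  have hc₁d : Differentiable ℝ c₁ := fun q => (hκw q).differentiableAt
  have hc₁x : ∀ q, fderiv ℝ c₁ q (0, 1) = κ' (w q) * fderiv ℝ w q (0, 1) := by
    intro q; rw [hc₁, (hκw q).fderiv]; simp [smul_eq_mul]
  have hPDE1 : ∀ q, fderiv ℝ r q (1, 0) + c₁ q * fderiv ℝ r q (0, 1) = 0 := by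
    intro q; rw [hrD, hrD, hc₁, hsys1, hsys2]; ring
  have hX' : ∀ z, HasDerivAt X (c₁ (z, X z)) z := fun z => by simpa [hc₁] using hX z
  -- John's weight and its bound
  set H : ℝ := (|Real.log κlo| + |Real.log κhi|) / 2 with hHdef
  have hlogbd : ∀ q, |Real.log (κ (w q)) / 2| ≤ H := by
    intro q
    have h1 : Real.log κlo ≤ Real.log (κ (w q)) := Real.log_le_log hκlo0 (hκlo q)
    have h2 : Real.log (κ (w q)) ≤ Real.log κhi := Real.log_le_log (hκpos q) (hκhi q)
    rw [abs_div, abs_two, hHdef]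
    have : |Real.log (κ (w q))| ≤ |Real.log κlo| + |Real.log κhi| := by
      rcases le_total 0 (Real.log (κ (w q))) with h0 | h0
      · rw [abs_of_nonneg h0]; linarith [le_abs_self (Real.log κhi), abs_nonneg (Real.log κlo)]
      · rw [abs_of_nonpos h0]; linarith [neg_abs_le (Real.log κlo), abs_nonneg (Real.log κhi)]
    linarith
  have halong : ∀ z, HasDerivAt (fun t => Real.log (κ (w (t, X t))) / 2)
      (κ' (w (z, X z)) * (fderiv ℝ w (z, X z) (1, 0) + 1 * κ (w (z, X z)) * fderiv ℝ w (z, X z) (0, 1)) /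
        (2 * κ (w (z, X z)))) z := by
    intro z
    have hX1 : ∀ z, HasDerivAt X (1 * κ (w (z, X z))) z := fun z => by simpa using hX z
    have hwz := hasDerivAt_along (F := w) (hw1 (z, X z)) (hX1 z)
    have hκz := (hκd (w (z, X z))).comp z hwz
    have hκne : κ (w (z, X z)) ≠ 0 := (hκpos _).ne'
    have hlog := (hκz.log hκne).div_const 2
    refine hlog.congr_deriv ?_
    simp only [Function.comp_apply]
    field_simp
  -- the damped law for `α = r_x ∘ X`
  have hα : ∀ z, HasDerivAt (fun t => fderiv ℝ r (t, X t) (0, 1))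
      (-(κ' (w (z, X z)) / (2 * κ (w (z, X z))) * fderiv ℝ r (z, X z) (0, 1) ^ 2) -
        κ' (w (z, X z)) * (fderiv ℝ w (z, X z) (1, 0) + 1 * κ (w (z, X z)) * fderiv ℝ w (z, X z) (0, 1)) /
          (2 * κ (w (z, X z))) * fderiv ℝ r (z, X z) (0, 1)) z := by
    intro z
    have hL := transversal_deriv_along_of_speed hr2 hc₁d hPDE1 hX' z
    refine hL.congr_deriv ?_
    rw [hc₁x, hrD, hsys2]
    have hκne : κ (w (z, X z)) ≠ 0 := (hκpos _).ne'
    field_simp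
    ring
  -- the minorant `κ'(w)/(2κhi)` with antiderivative `A/(2κhi)`
  have h2κ : 0 < 2 * κhi := by positivity
  have hã : ∀ z ∈ Icc z₁ z₀, 0 ≤ κ' (w (z, X z)) / (2 * κhi) := fun z _ => div_nonneg (hgnl _) h2κ.le
  have hãa : ∀ z ∈ Icc z₁ z₀, κ' (w (z, X z)) / (2 * κhi) ≤ κ' (w (z, X z)) / (2 * κ (w (z, X z))) := fun z _ =>
    div_le_div_of_nonneg_left (hgnl _) (by linarith [hκpos (z, X z)]) (by linarith [hκhi (z, X z)])
  have hAd : ∀ z ∈ Icc z₁ z₀, HasDerivAt (fun z => A z / (2 * κhi)) (κ' (w (z, X z)) / (2 * κhi)) z :=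
    fun z _ => (hA z).div_const _
  have hpos' : 0 < fderiv ℝ r (z₀, X z₀) (0, 1) := by rw [hrD]; exact hpos
  have hbud := dampedRiccati_backward_budget (α := fun t => fderiv ℝ r (t, X t) (0, 1))
    (a := fun z => κ' (w (z, X z)) / (2 * κ (w (z, X z))))
    (h := fun t => Real.log (κ (w (t, X t))) / 2) hz hã hãa (fun z _ => hlogbd _) (fun z _ => halong z) hAd
    (fun z _ => hα z) hpos'
  -- unpack: `A z₀/(2κhi) − A z₁/(2κhi) < e^{2H}/r_x`
  have h2H : 2 * H = |Real.log κlo| + |Real.log κhi| := by rw [hHdef]; ring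
  rw [h2H] at hbud
  have hrx : fderiv ℝ r (z₀, X z₀) (0, 1) =
      fderiv ℝ p (z₀, X z₀) (0, 1) + κ (w (z₀, X z₀)) * fderiv ℝ w (z₀, X z₀) (0, 1) := hrD _ _
  rw [hrx] at hbud
  have hsub : A z₀ / (2 * κhi) - A z₁ / (2 * κhi) = (A z₀ - A z₁) / (2 * κhi) := by ring
  rw [hsub, div_lt_iff₀ h2κ] at hbud
  calc A z₀ - A z₁ < Real.exp (|Real.log κlo| + |Real.log κhi|) /
        (fderiv ℝ p (z₀, X z₀) (0, 1) + κ (w (z₀, X z₀)) * fderiv ℝ w (z₀, X z₀) (0, 1)) * (2 * κhi) := hbud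
    _ = 2 * κhi * Real.exp (|Real.log κlo| + |Real.log κhi|) /
        (fderiv ℝ p (z₀, X z₀) (0, 1) + κ (w (z₀, X z₀)) * fderiv ℝ w (z₀, X z₀) (0, 1)) := by ring

end Summit.NavierStokesRegularity.NavierStokesRegularity.Theorems.PoloidalWindowDoorPoloidalWindowRigidityZShockPSystemBackwardBudget

end
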